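import Literature.NumberTheory.LFunctions.VinogradovKorobovLargeHeightMain
import Literature.NumberTheory.LFunctions.VinogradovKorobovIntermediate
import HarnessLib

/-!
# RH family, wave 0 — proofs: the Vinogradov–Korobov region of Mossinghoff–Trudgian–Yang (rh.S10), reduction to four printed inputs

Topic: `Literature/NumberTheory/LFunctions`. Sibling proof file of `RHWave0.lean` for the named fact
`Literature.NumberTheory.LFunctions.zero_free_region_vinogradov_korobov` (**rh.S10**): `ζ(σ + it) ≠ 0` for
`|t| ≥ 3` and `σ ≥ 1 − 1/(55.241 (log|t|)^{2/3} (log log|t|)^{1/3})` — Theorem 1.1 of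
M. J. Mossinghoff, T. S. Trudgian, A. Yang, *Explicit zero-free regions for the Riemann
zeta-function*, Res. Number Theory **10** (2024), no. 11 = arXiv:2212.06867 (bib key
`MossinghoffTrudgianYangRNT2024`; `MossinghoffTrudgianYang2024` cited in `RHWave0.lean` is the interim
stub of the same paper; theorem/lemma/equation numbers below are those of the arXiv version). The
vendored statement was checked against p. 1 (abstract) and Theorem 1.1 (p. 3) of the source and is
faithful (the bound `σ ≥ 1 − ν(t)` with `≥`, threshold `|t| ≥ 3`, constant `55.241`).

## Status of the discharge: not discharged (XL), reduced to four printed inputs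

`zero_free_region_vinogradov_korobov_holds` is **not** proved here. The printed proof (§5 of the
source) rests on four inputs each of which is a theory of its own, vendored in the tree as NAMED
FACTS (D-0014):

1. `Literature.NumberTheory.LFunctions.zero_free_region_mossinghoff_trudgian_yang` — Theorem 1.3 of the source, the
   explicit classical region `σ ≥ 1 − 1/(5.558691 log|t|)`, `|t| ≥ 2` (**rh.S09**; Kadiri's method
   with the Jang–Kwon smoothing, a degree-46 trigonometric polynomial and the Platt–Trudgian
   verification of RH to height `3·10¹²`, §9 of the source);
2. `Literature.NumberTheory.LFunctions.zeta_bound_ford` — Ford's Richert-type bound (3.1),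
   `|ζ(σ + it)| ≤ 76.2 |t|^{4.45(1−σ)^{3/2}} (log|t|)^{2/3}` (Ford, Proc. LMS 85 (2002), Thm. 1:
   the explicit Vinogradov mean-value / exponential-sum theory);
3. `Literature.NumberTheory.LFunctions.zero_inequality_mossinghoff_trudgian_yang` — Lemma 4.7 of the source (the zero
   inequality of Ford's mollified "zero detector", Lemmas 4.1–4.6, for the polynomial `P₄₀`, with
   Ramaré's (3.2) and the Hasanalizade–Shen–Wong bound (3.8) for `N(T)` inside);
4. `Literature.NumberTheory.LFunctions.zero_inequality_intermediate_mossinghoff_trudgian_yang` — Lemma 6.1 of the source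
   (the same detector with `η = 1/2` and Patel's sub-Weyl bound (3.3)).

**Everything between these four inputs and Theorem 1.1 is proved in the tree** (files
`VinogradovKorobov*.lean`): the admissibility of `P₄₀` (`VinogradovKorobovPolynomial.lean`), the
constants `θ`, `w(0)`, `W'(0)`, `C₅(416)` (`…Numerics.lean`), Theorem 1.4 for `|t| ≥ exp 1001` from
Lemma 6.1 and Theorem 1.3 (`…Intermediate.lean`, §6 of the source), the large-height bound
`Z(β, t) ≥ M₁ = 0.048976` for `t ≥ exp 52238` from Lemma 4.7, (3.1) and Theorem 1.4-from-`exp 7000`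
(`…LargeHeight*.lean`, §5 of the source, with the slip in (5.12) corrected and (5.14) sharpened —
see the caveat recorded with `zero_bound_large_height_mossinghoff_trudgian_yang`), and the assembly
with the certified crossovers `log|t| ≶ 7000`, `52238` (`VinogradovKorobov.lean`). This file closes
the DAG into ONE theorem whose hypotheses are exactly the four named facts above (Theorem 1.4
itself, for `|t| ≥ exp 1001`, from Theorem 1.3 and Lemma 6.1 is
`Literature.NumberTheory.LFunctions.zero_free_region_intermediate_of_zero_inequality` of `VinogradovKorobovIntermediate.lean`):

* `Literature.NumberTheory.LFunctions.VK.intermediateRegionFrom_exp_7000_of_zero_inequality` — Theorem 1.3 ∧ Lemma 6.1 ⟹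
  the intermediate region from height `exp 7000` (from `exp 1001` in fact);
* `Literature.NumberTheory.LFunctions.zero_bound_large_height_of_inputs` — (3.1) ∧ Theorem 1.3 ∧ Lemma 4.7 ∧ Lemma 6.1
  ⟹ the §5 bound `zero_bound_large_height_mossinghoff_trudgian_yang`;
* `Literature.NumberTheory.LFunctions.zero_free_region_vinogradov_korobov_of_inputs` — **Theorem 1.3 ∧ (3.1) ∧ Lemma 4.7 ∧
  Lemma 6.1 ⟹ rh.S10.** Hence the trust base of any user of `(h : zero_free_region_vinogradov_korobov)`
  can be traded for these four names, and discharging them discharges rh.S10 with no further work.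

What a discharge of the leaves would take (recorded for the planner; none is attempted here):
(1) is rh.S09 and contains a certified computation (RH to `3·10¹²`) with no kernel-checkable
certificate; (2) is Ford's 70-page explicit version of the Vinogradov–Korobov method; (3)–(4) descend
from Ford, *Zero-free regions for the Riemann zeta function* (2002), Lemmas 2.2, 3.4, 4.2, 4.3, 5.1,
7.1 — the zero-detector identity (Lemma 4.1 of the source) is a Poisson–Jensen-type formula in a
strip for `ζ`, not available in Mathlib, and Lemmas 4.5–4.6 consume the explicit `N(T)` bound (3.8).

## References

* M. J. Mossinghoff, T. S. Trudgian, A. Yang, op. cit.: Theorem 1.1 (p. 3), Theorems 1.3, 1.4,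
  (3.1)–(3.3), (3.8), Lemmas 4.7, 6.1, §5 (proof of Theorem 1.1), §6 (`MossinghoffTrudgianYangRNT2024`).
* K. Ford, *Vinogradov's integral and bounds for the Riemann zeta function*, Proc. London Math. Soc.
  (3) 85 (2002), 565–633, Theorem 1 (`Ford2002`).
* K. Ford, *Zero-free regions for the Riemann zeta function*, Number Theory for the Millennium II
  (2002), 25–56 = arXiv:1910.08205 (`Ford2002Millennium`).
-/

noncomputable section

open Complex Real

namespace Literature.NumberTheory.LFunctions

namespace VK

/-- **Theorem 1.4 from height `exp 7000`, from Theorem 1.3 and Lemma 6.1.** The in-tree proof of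
Theorem 1.4 from the zero inequality Lemma 6.1 (`zero_free_region_intermediate_of_zero_inequality`,
§6 of the source, valid for `|t| ≥ exp 1001`) gives in particular `IntermediateRegionFrom (exp 7000)`,
the form of Theorem 1.4 consumed by the §5 argument and by the assembly of rh.S10.
[cite: MossinghoffTrudgianYangRNT2024, Theorem 1.4 and §6] -/
theorem intermediateRegionFrom_exp_7000_of_zero_inequality
    (hC : zero_free_region_mossinghoff_trudgian_yang)
    (hZ6 : zero_inequality_intermediate_mossinghoff_trudgian_yang) :
    IntermediateRegionFrom (Real.exp 7000) :=
  fun σ t ht hσ ↦ zero_free_region_intermediate_of_zero_inequality hC hZ6 σ t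
    ((Real.exp_le_exp.2 (by norm_num)).trans ht) hσ

end VK

open VK in
/-- **The large-height bound of §5 of Mossinghoff–Trudgian–Yang from the four printed inputs.**
Ford's bound (3.1), Theorem 1.3, Lemma 4.7 and Lemma 6.1 imply that every zero `β + it` of `ζ` with
`t ≥ exp 52238` has `(1 − β) · 4.45^{2/3} (log t)^{2/3} (log log t)^{1/3} ≥ 0.048976`
(`zero_bound_large_height_mossinghoff_trudgian_yang`): Theorem 1.4 from `exp 7000` by
`VK.intermediateRegionFrom_exp_7000_of_zero_inequality`, then
`VK.zero_bound_large_height_of_zero_inequality'`.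
[cite: MossinghoffTrudgianYangRNT2024, §5 (proof of Theorem 1.1 for t ≥ T₀)] -/
theorem zero_bound_large_height_of_inputs (hF : zeta_bound_ford)
    (hC : zero_free_region_mossinghoff_trudgian_yang)
    (hZ47 : zero_inequality_mossinghoff_trudgian_yang)
    (hZ6 : zero_inequality_intermediate_mossinghoff_trudgian_yang) :
    zero_bound_large_height_mossinghoff_trudgian_yang :=
  zero_bound_large_height_of_zero_inequality' hF
    (intermediateRegionFrom_exp_7000_of_zero_inequality hC hZ6) hZ47

open VK in
/-- **rh.S10 from the four printed inputs of Mossinghoff–Trudgian–Yang (Theorem 1.1, proof of §5,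
with §6).** The explicit classical region (Theorem 1.3, rh.S09), Ford's Richert-type bound (3.1) and
the two zero inequalities Lemma 4.7 and Lemma 6.1 imply the Vinogradov–Korobov region
`σ ≥ 1 − 1/(55.241 (log|t|)^{2/3} (log log|t|)^{1/3})`, `|t| ≥ 3` (`zero_free_region_vinogradov_korobov`):
by `zero_free_region_vinogradov_korobov_of_parts'` (certified crossovers at `log|t| = 7000`, `52238`)
fed with Theorem 1.4-from-`exp 7000` (`VK.intermediateRegionFrom_exp_7000_of_zero_inequality`) and the
§5 bound (`zero_bound_large_height_of_inputs`). These four hypotheses are exactly the named facts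
that remain undischarged below rh.S10 in the tree.
[cite: MossinghoffTrudgianYangRNT2024, Theorem 1.1 (proof: §5, §6)] -/
theorem zero_free_region_vinogradov_korobov_of_inputs
    (hC : zero_free_region_mossinghoff_trudgian_yang) (hF : zeta_bound_ford)
    (hZ47 : zero_inequality_mossinghoff_trudgian_yang)
    (hZ6 : zero_inequality_intermediate_mossinghoff_trudgian_yang) :
    zero_free_region_vinogradov_korobov :=
  zero_free_region_vinogradov_korobov_of_parts' hC
    (intermediateRegionFrom_exp_7000_of_zero_inequality hC hZ6)
    (zero_bound_large_height_of_inputs hF hC hZ47 hZ6)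

end Literature.NumberTheory.LFunctions
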